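import Summits.AtomisticToContinuum.Crystallization.Theses.SquareWellLayerCake
import Literature.MathematicalPhysics.StatisticalMechanics.LennardJonesClusters
import Literature.Geometry.DiscreteGeometry.SphericalCodeHemisphere
import Literature.Geometry.DiscreteGeometry.TammesThirteen

/-!
# `TwelveWithinOne` (crux stmt-AtomisticToContinuum-15808, route `SquareWellLayerCake`): negative-side support —
# minimality and the potential are load-bearing, the count `12` is sharp, surface sites are always defects

Def-free landed copy of Parts A–C of the refuter's crux workfile
`Cruxes/TwelveWithinOne/Disproof.lean` (cdisprove seat, cycle 1): every weakened / strengthened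
variant of the crux is spelled out INLINE in the theorem that negates it (no proposition is defined
under `Summits/`). This file does NOT refute the crux.

Crux (K2 of the route): for every sequence of Lennard-Jones ground states the fraction of particles
`i` failing
`Good i := [every particle within 11/10 of x_i (x_i included) is 55/57-separated from all others]
  ∧ [at least 12 particles j ≠ i with dist(x_i, x_j) ≤ 1]`
tends to `0` (`V_LJ = r⁻¹²/12 − r⁻⁶/6`, minimum at `r = 1`; ground states are injective minimisers,
`Literature…Crystallization.IsGroundState`).

## Why the crux itself resists (no kill)

`¬ K2` asks for actual Lennard-Jones minimisers, for infinitely many `N`, carrying a positive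
DENSITY of defect sites. The only a-priori information on 3-D LJ minimisers in print or in tree is
existence (`LennardJonesGroundStatesExist_holds`), the uniform minimal distance (`1/3` proved, `0.684`
named), site energies `≤ 0` and energy bounds — none forces a defect anywhere except at the boundary
(Part C: every particle extreme in some direction IS a defect, but hull vertices are `o(N)`).
Conversely the conjectured minimiser (hcp/fcc bulk, `a* = 0.97123`) is Good at every interior site
with margins `0.65 %` (`a* − 55/57`) and `2.9 %` (`1 − a*`), second shell `√2·a* = 1.3735 > 11/10`;
no formalisation defect short-cuts this (no junk values, hypothesis not vacuous, predicate
satisfiable — the fcc shell, `goodWith_twelve_fcc13` in the workfile).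

## What is proved (sorry-free; axioms `propext`, `Classical.choice`, `Quot.sound`)

* Part A — LOAD-BEARING HYPOTHESES. `twelveWithinOne_false_without_minimality`: energy minimisation
  dropped (injectivity kept) ⇒ FALSE (collinear configuration `i ↦ 2i·e₀`).
  `twelveWithinOne_false_for_zero_potential`: the same statement for `V = 0` (every configuration of
  distinct points is a ground state) is FALSE — a proof must use the attractive well of `V_LJ`.
* Part B — THE COUNT IS SHARP (modulo the named fact `musinTarasov2012_tammes_thirteen`):
  `card_nbrs_le_twelve` — at a `55/57`-separated site at most twelve particles lie within distance
  `1` (bond directions form a spherical code of chord `≥ 55/57 > 0.957`); hence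
  `twelveWithinOne_false_with_thirteen`: `12 ↦ 13` makes the crux FALSE. Under K2 a.e. site has
  EXACTLY twelve within `1`; K1 (`AveragedTwelve`) is needed in `closes` only for the empty shell
  `(1, 11/10]`.
* Part C — THE EXCEPTIONAL SET IS ESSENTIAL (unconditional). `not_good_of_extreme`: in ANY finite
  configuration a particle extreme in some direction fails `Good` (its `≥ 12` bond directions would
  lie in a closed hemisphere pairwise at `cos ≤ 1 − (55/57)²/2 = 0.5345`, against the cap-packing
  bound `card_mul_le_of_code_in_hemisphere` with `c = 219/250`: `12·(1 − c) = 1.488 > 1.48231 ≥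
  1 + √(1 − c²)`); `exists_not_good`, `one_le_card_bad` (the defect set is never empty, `N ≥ 1`, any
  configuration) and `twelveWithinOne_false_everywhere`: "eventually every particle is Good" is FALSE.
-/

noncomputable section

namespace Summit.AtomisticToContinuum.Crystallization.Theorems.TwelveWithinOne.Negative

open scoped BigOperators
open Filter Finset RealInnerProductSpace
open Literature.MathematicalPhysics.StatisticalMechanics
open Literature.Geometry.DiscreteGeometry

/-- Skeleton of every negative statement below: if a site predicate fails at EVERY site for all
`N ≥ 1`, the defect fraction is eventually `1` and does not tend to `0`. [folklore] -/
theorem not_tendsto_of_forall_not {P : (N : ℕ) → Fin N → Prop}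
    (hP : ∀ N : ℕ, 1 ≤ N → ∀ i : Fin N, ¬ P N i) :
    ¬ Tendsto (fun N : ℕ => (Nat.card {i : Fin N // ¬ P N i} : ℝ) / N) atTop (nhds 0) := by
  intro h
  have h1 : (fun N : ℕ => (Nat.card {i : Fin N // ¬ P N i} : ℝ) / N) =ᶠ[atTop]
      fun _ => (1 : ℝ) := by
    filter_upwards [eventually_ge_atTop 1] with N hN
    have hc : Nat.card {i : Fin N // ¬ P N i} = N := by
      rw [Nat.card_congr (Equiv.subtypeUnivEquiv (hP N hN)), Nat.card_eq_fintype_card,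
        Fintype.card_fin]
    have hN' : (N : ℝ) ≠ 0 := Nat.cast_ne_zero.2 (by omega)
    rw [hc, div_self hN']
  exact zero_ne_one (tendsto_nhds_unique (h.congr' h1) tendsto_const_nhds)

/-! ## Part A — load-bearing hypotheses: minimality, and the potential itself -/

/-- Distinct particles of the spread configuration are at distance `≥ 2`. [folklore] -/
theorem two_le_dist_spread {N : ℕ} {i j : Fin N} (hij : i ≠ j) :
    2 ≤ dist ((EuclideanSpace.single (0 : Fin 3) (2 * ((i : ℕ) : ℝ)) : EuclideanSpace ℝ (Fin 3))) ((EuclideanSpace.single (0 : Fin 3) (2 * ((j : ℕ) : ℝ)) : EuclideanSpace ℝ (Fin 3))) := by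
  have h : dist ((EuclideanSpace.single (0 : Fin 3) (2 * ((i : ℕ) : ℝ)) : EuclideanSpace ℝ (Fin 3))) ((EuclideanSpace.single (0 : Fin 3) (2 * ((j : ℕ) : ℝ)) : EuclideanSpace ℝ (Fin 3))) = |2 * ((i : ℕ) : ℝ) - 2 * ((j : ℕ) : ℝ)| := by
    simp [Real.dist_eq]
  rw [h]
  have hne : (i : ℕ) ≠ (j : ℕ) := fun h' => hij (Fin.ext h')
  rcases Nat.lt_or_gt_of_ne hne with hlt | hlt
  · have : ((i : ℕ) : ℝ) + 1 ≤ ((j : ℕ) : ℝ) := by exact_mod_cast hlt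
    rw [abs_of_nonpos (by linarith)]; linarith
  · have : ((j : ℕ) : ℝ) + 1 ≤ ((i : ℕ) : ℝ) := by exact_mod_cast hlt
    rw [abs_of_nonneg (by linarith)]; linarith

/-- The spread configuration consists of distinct points. [folklore] -/
theorem spread_injective (N : ℕ) : Function.Injective (fun i : Fin N => (EuclideanSpace.single (0 : Fin 3) (2 * ((i : ℕ) : ℝ)) : EuclideanSpace ℝ (Fin 3))) := by
  intro i j h
  by_contra hij
  have h2 := two_le_dist_spread (N := N) hij
  have h' : (EuclideanSpace.single (0 : Fin 3) (2 * ((i : ℕ) : ℝ)) : EuclideanSpace ℝ (Fin 3)) = (EuclideanSpace.single (0 : Fin 3) (2 * ((j : ℕ) : ℝ)) : EuclideanSpace ℝ (Fin 3)) := h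
  rw [h', dist_self] at h2
  linarith

/-- No particle of the spread configuration has a neighbour within distance `1`. [folklore] -/
theorem nbrs_spread {N : ℕ} (i : Fin N) : (Finset.filter (fun j : Fin N => j ≠ i ∧ dist ((EuclideanSpace.single (0 : Fin 3) (2 * ((i : ℕ) : ℝ)) : EuclideanSpace ℝ (Fin 3))) ((EuclideanSpace.single (0 : Fin 3) (2 * ((j : ℕ) : ℝ)) : EuclideanSpace ℝ (Fin 3))) ≤ 1) Finset.univ) = ∅ := by
  rw [Finset.filter_eq_empty_iff]
  rintro j - ⟨hji, hd⟩
  have := two_le_dist_spread (N := N) (Ne.symm hji)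
  linarith

/-- **Minimality is load-bearing**: the crux with energy minimisation DROPPED (injectivity, the other
half of `IsGroundState`, kept) is false — witness the spread configuration. [folklore] -/
theorem twelveWithinOne_false_without_minimality :
    ¬ ∀ x : (N : ℕ) → (Fin N → EuclideanSpace ℝ (Fin 3)), (∀ N, Function.Injective (x N)) →
      Tendsto (fun N : ℕ => (Nat.card {i : Fin N // ¬ ((∀ j : Fin N, dist (x N i) (x N j) ≤ 11 / 10 →
        ∀ k : Fin N, k ≠ j → (55 : ℝ) / 57 ≤ dist (x N j) (x N k)) ∧
        12 ≤ (Finset.univ.filter fun j : Fin N => j ≠ i ∧ dist (x N i) (x N j) ≤ 1).card)} : ℝ) / N)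
        atTop (nhds 0) := by
  intro h
  refine not_tendsto_of_forall_not
    (P := fun N i => (∀ j : Fin N, dist ((EuclideanSpace.single (0 : Fin 3) (2 * ((i : ℕ) : ℝ)) : EuclideanSpace ℝ (Fin 3))) ((EuclideanSpace.single (0 : Fin 3) (2 * ((j : ℕ) : ℝ)) : EuclideanSpace ℝ (Fin 3))) ≤ 11 / 10 →
        ∀ k : Fin N, k ≠ j → (55 : ℝ) / 57 ≤ dist ((EuclideanSpace.single (0 : Fin 3) (2 * ((j : ℕ) : ℝ)) : EuclideanSpace ℝ (Fin 3))) ((EuclideanSpace.single (0 : Fin 3) (2 * ((k : ℕ) : ℝ)) : EuclideanSpace ℝ (Fin 3)))) ∧ 12 ≤ ((Finset.filter (fun j : Fin N => j ≠ i ∧ dist ((EuclideanSpace.single (0 : Fin 3) (2 * ((i : ℕ) : ℝ)) : EuclideanSpace ℝ (Fin 3))) ((EuclideanSpace.single (0 : Fin 3) (2 * ((j : ℕ) : ℝ)) : EuclideanSpace ℝ (Fin 3))) ≤ 1) Finset.univ)).card)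
    (fun N _ i hgood => ?_) (h (fun N i => (EuclideanSpace.single (0 : Fin 3) (2 * ((i : ℕ) : ℝ)) : EuclideanSpace ℝ (Fin 3))) spread_injective)
  have h0 := hgood.2
  rw [nbrs_spread, Finset.card_empty] at h0
  omega

/-- **The potential is load-bearing**: the crux stated for the ZERO potential (every configuration
of distinct points is a ground state, `isGroundState_zero`) is false. [folklore] -/
theorem twelveWithinOne_false_for_zero_potential :
    ¬ ∀ x : (N : ℕ) → (Fin N → EuclideanSpace ℝ (Fin 3)), (∀ N, IsGroundState (fun _ => (0 : ℝ)) (x N)) →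
      Tendsto (fun N : ℕ => (Nat.card {i : Fin N // ¬ ((∀ j : Fin N, dist (x N i) (x N j) ≤ 11 / 10 →
        ∀ k : Fin N, k ≠ j → (55 : ℝ) / 57 ≤ dist (x N j) (x N k)) ∧
        12 ≤ (Finset.univ.filter fun j : Fin N => j ≠ i ∧ dist (x N i) (x N j) ≤ 1).card)} : ℝ) / N)
        atTop (nhds 0) := by
  intro h
  refine not_tendsto_of_forall_not
    (P := fun N i => (∀ j : Fin N, dist ((EuclideanSpace.single (0 : Fin 3) (2 * ((i : ℕ) : ℝ)) : EuclideanSpace ℝ (Fin 3))) ((EuclideanSpace.single (0 : Fin 3) (2 * ((j : ℕ) : ℝ)) : EuclideanSpace ℝ (Fin 3))) ≤ 11 / 10 →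
        ∀ k : Fin N, k ≠ j → (55 : ℝ) / 57 ≤ dist ((EuclideanSpace.single (0 : Fin 3) (2 * ((j : ℕ) : ℝ)) : EuclideanSpace ℝ (Fin 3))) ((EuclideanSpace.single (0 : Fin 3) (2 * ((k : ℕ) : ℝ)) : EuclideanSpace ℝ (Fin 3)))) ∧ 12 ≤ ((Finset.filter (fun j : Fin N => j ≠ i ∧ dist ((EuclideanSpace.single (0 : Fin 3) (2 * ((i : ℕ) : ℝ)) : EuclideanSpace ℝ (Fin 3))) ((EuclideanSpace.single (0 : Fin 3) (2 * ((j : ℕ) : ℝ)) : EuclideanSpace ℝ (Fin 3))) ≤ 1) Finset.univ)).card)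
    (fun N _ i hgood => ?_)
    (h (fun N i => (EuclideanSpace.single (0 : Fin 3) (2 * ((i : ℕ) : ℝ)) : EuclideanSpace ℝ (Fin 3))) fun N => isGroundState_zero (spread_injective N))
  have h0 := hgood.2
  rw [nbrs_spread, Finset.card_empty] at h0
  omega

/-! ## Part B — the spherical code of bond directions at a separated site; sharpness of `12` -/

/-- Two bonds `p, q` of lengths in `[55/57, 1]` whose far ends are `≥ 55/57` apart make an angle
with cosine `≤ 1 − (55/57)²/2` (worst case: both of length `1`). [folklore] -/
theorem inner_normalized_le {p q : EuclideanSpace ℝ (Fin 3)} (hp1 : (55 : ℝ) / 57 ≤ ‖p‖) (hp2 : ‖p‖ ≤ 1)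
    (hq1 : (55 : ℝ) / 57 ≤ ‖q‖) (hq2 : ‖q‖ ≤ 1) (hpq : (55 : ℝ) / 57 ≤ ‖p - q‖) :
    ⟪‖p‖⁻¹ • p, ‖q‖⁻¹ • q⟫ ≤ 1 - ((55 : ℝ) / 57) ^ 2 / 2 := by
  have hp0 : 0 < ‖p‖ := by linarith
  have hq0 : 0 < ‖q‖ := by linarith
  have hinner : ⟪p, q⟫ = (‖p‖ ^ 2 + ‖q‖ ^ 2 - ‖p - q‖ ^ 2) / 2 := by
    rw [norm_sub_sq_real]; ring
  have hpq2 : ((55 : ℝ) / 57) ^ 2 ≤ ‖p - q‖ ^ 2 := pow_le_pow_left₀ (by norm_num) hpq 2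
  have key : ⟪p, q⟫ ≤ (1 - ((55 : ℝ) / 57) ^ 2 / 2) * (‖p‖ * ‖q‖) := by
    rw [hinner]
    nlinarith [mul_nonneg (sub_nonneg.2 hp2) (sub_nonneg.2 hp1),
      mul_nonneg (sub_nonneg.2 hq2) (sub_nonneg.2 hq1),
      mul_nonneg (sub_nonneg.2 hp2) (sub_nonneg.2 hq2)]
  rw [real_inner_smul_left, real_inner_smul_right, ← mul_assoc, ← mul_inv,
    inv_mul_le_iff₀ (by positivity)]
  linarith [key]

variable {N : ℕ}

/-- At a separated site the bonds to neighbours within `1` have lengths in `[55/57, 1]`.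
[folklore] -/
theorem norm_sub_mem {x : Fin N → EuclideanSpace ℝ (Fin 3)} {i j : Fin N} (hsep : (∀ j, dist (x i) (x j) ≤ 11 / 10 → ∀ k, k ≠ j → (55 : ℝ) / 57 ≤ dist (x j) (x k))) (hj : j ∈ (Finset.filter (fun j => j ≠ i ∧ dist (x i) (x j) ≤ 1) Finset.univ)) :
    (55 : ℝ) / 57 ≤ ‖x j - x i‖ ∧ ‖x j - x i‖ ≤ 1 := by
  simp only [Finset.mem_filter, Finset.mem_univ, true_and] at hj
  rw [← dist_eq_norm, dist_comm]
  exact ⟨hsep i (by rw [dist_self]; norm_num) j hj.1, hj.2⟩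

/-- … and distinct neighbours are `≥ 55/57` apart. [folklore] -/
theorem norm_sub_sub {x : Fin N → EuclideanSpace ℝ (Fin 3)} {i j k : Fin N} (hsep : (∀ j, dist (x i) (x j) ≤ 11 / 10 → ∀ k, k ≠ j → (55 : ℝ) / 57 ≤ dist (x j) (x k))) (hj : j ∈ (Finset.filter (fun j => j ≠ i ∧ dist (x i) (x j) ≤ 1) Finset.univ))
    (hjk : j ≠ k) : (55 : ℝ) / 57 ≤ ‖(x j - x i) - (x k - x i)‖ := by
  rw [sub_sub_sub_cancel_right, ← dist_eq_norm]
  simp only [Finset.mem_filter, Finset.mem_univ, true_and] at hj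
  exact hsep j (hj.2.trans (by norm_num)) k hjk.symm

/-- Bond directions at a separated site are unit vectors. [folklore] -/
theorem norm_dir {x : Fin N → EuclideanSpace ℝ (Fin 3)} {i j : Fin N} (hsep : (∀ j, dist (x i) (x j) ≤ 11 / 10 → ∀ k, k ≠ j → (55 : ℝ) / 57 ≤ dist (x j) (x k))) (hj : j ∈ (Finset.filter (fun j => j ≠ i ∧ dist (x i) (x j) ≤ 1) Finset.univ)) :
    ‖(‖x j - x i‖⁻¹ • (x j - x i))‖ = 1 := by
  have h0 : 0 < ‖x j - x i‖ := by linarith [(norm_sub_mem hsep hj).1]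
  rw [norm_smul, norm_inv, norm_norm, inv_mul_cancel₀ h0.ne']

/-- Pairwise inner products of bond directions at a separated site are `≤ 1 − (55/57)²/2`.
[folklore] -/
theorem inner_dir_le {x : Fin N → EuclideanSpace ℝ (Fin 3)} {i j k : Fin N} (hsep : (∀ j, dist (x i) (x j) ≤ 11 / 10 → ∀ k, k ≠ j → (55 : ℝ) / 57 ≤ dist (x j) (x k))) (hj : j ∈ (Finset.filter (fun j => j ≠ i ∧ dist (x i) (x j) ≤ 1) Finset.univ))
    (hk : k ∈ (Finset.filter (fun j => j ≠ i ∧ dist (x i) (x j) ≤ 1) Finset.univ)) (hjk : j ≠ k) : ⟪(‖x j - x i‖⁻¹ • (x j - x i)), (‖x k - x i‖⁻¹ • (x k - x i))⟫ ≤ 1 - ((55 : ℝ) / 57) ^ 2 / 2 :=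
  inner_normalized_le (norm_sub_mem hsep hj).1 (norm_sub_mem hsep hj).2 (norm_sub_mem hsep hk).1
    (norm_sub_mem hsep hk).2 (norm_sub_sub hsep hj hjk)

/-- Distinct neighbours have distinct bond directions. [folklore] -/
theorem dir_injOn {x : Fin N → EuclideanSpace ℝ (Fin 3)} {i : Fin N} (hsep : (∀ j, dist (x i) (x j) ≤ 11 / 10 → ∀ k, k ≠ j → (55 : ℝ) / 57 ≤ dist (x j) (x k))) :
    Set.InjOn (fun j => (‖x j - x i‖⁻¹ • (x j - x i))) ((Finset.filter (fun j => j ≠ i ∧ dist (x i) (x j) ≤ 1) Finset.univ)) := by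
  intro j hj k hk hjk
  by_contra hne
  have h1 := inner_dir_le hsep hj hk hne
  have hjk' : (‖x j - x i‖⁻¹ • (x j - x i)) = (‖x k - x i‖⁻¹ • (x k - x i)) := hjk
  rw [hjk', real_inner_self_eq_norm_sq, norm_dir hsep hk] at h1
  norm_num at h1

/-- The code has as many elements as there are neighbours within `1`. [folklore] -/
theorem card_code {x : Fin N → EuclideanSpace ℝ (Fin 3)} {i : Fin N} (hsep : (∀ j, dist (x i) (x j) ≤ 11 / 10 → ∀ k, k ≠ j → (55 : ℝ) / 57 ≤ dist (x j) (x k))) :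
    ((Finset.image (fun j => ‖x j - x i‖⁻¹ • (x j - x i)) (Finset.filter (fun j => j ≠ i ∧ dist (x i) (x j) ≤ 1) Finset.univ))).card = ((Finset.filter (fun j => j ≠ i ∧ dist (x i) (x j) ≤ 1) Finset.univ)).card :=
  Finset.card_image_of_injOn (dir_injOn hsep)

/-- The code consists of unit vectors. [folklore] -/
theorem code_norm {x : Fin N → EuclideanSpace ℝ (Fin 3)} {i : Fin N} (hsep : (∀ j, dist (x i) (x j) ≤ 11 / 10 → ∀ k, k ≠ j → (55 : ℝ) / 57 ≤ dist (x j) (x k))) :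
    ∀ v ∈ (Finset.image (fun j => ‖x j - x i‖⁻¹ • (x j - x i)) (Finset.filter (fun j => j ≠ i ∧ dist (x i) (x j) ≤ 1) Finset.univ)), ‖v‖ = 1 := by
  intro v hv
  obtain ⟨j, hj, rfl⟩ := Finset.mem_image.1 hv
  exact norm_dir hsep hj

/-- The code has pairwise inner products `≤ 1 − (55/57)²/2`. [folklore] -/
theorem code_inner {x : Fin N → EuclideanSpace ℝ (Fin 3)} {i : Fin N} (hsep : (∀ j, dist (x i) (x j) ≤ 11 / 10 → ∀ k, k ≠ j → (55 : ℝ) / 57 ≤ dist (x j) (x k))) :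
    ∀ v ∈ (Finset.image (fun j => ‖x j - x i‖⁻¹ • (x j - x i)) (Finset.filter (fun j => j ≠ i ∧ dist (x i) (x j) ≤ 1) Finset.univ)), ∀ w ∈ (Finset.image (fun j => ‖x j - x i‖⁻¹ • (x j - x i)) (Finset.filter (fun j => j ≠ i ∧ dist (x i) (x j) ≤ 1) Finset.univ)), v ≠ w → ⟪v, w⟫ ≤ 1 - ((55 : ℝ) / 57) ^ 2 / 2 := by
  intro v hv w hw hvw
  obtain ⟨j, hj, rfl⟩ := Finset.mem_image.1 hv
  obtain ⟨k, hk, rfl⟩ := Finset.mem_image.1 hw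
  exact inner_dir_le hsep hj hk fun h => hvw (by simp only [h])

/-- The code has chord `≥ 55/57 > 0.957`, the threshold of the Tammes-13 fact. [folklore] -/
theorem code_dist {x : Fin N → EuclideanSpace ℝ (Fin 3)} {i : Fin N} (hsep : (∀ j, dist (x i) (x j) ≤ 11 / 10 → ∀ k, k ≠ j → (55 : ℝ) / 57 ≤ dist (x j) (x k))) :
    ∀ v ∈ (Finset.image (fun j => ‖x j - x i‖⁻¹ • (x j - x i)) (Finset.filter (fun j => j ≠ i ∧ dist (x i) (x j) ≤ 1) Finset.univ)), ∀ w ∈ (Finset.image (fun j => ‖x j - x i‖⁻¹ • (x j - x i)) (Finset.filter (fun j => j ≠ i ∧ dist (x i) (x j) ≤ 1) Finset.univ)), v ≠ w → (0.957 : ℝ) ≤ dist v w := by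
  intro v hv w hw hvw
  have hin := code_inner hsep v hv w hw hvw
  have hsq : dist v w ^ 2 = 2 - 2 * ⟪v, w⟫ := by
    rw [dist_eq_norm, norm_sub_sq_real, code_norm hsep v hv, code_norm hsep w hw]; ring
  nlinarith [dist_nonneg (x := v) (y := w)]

/-- **Sharpness of the count** (modulo Tammes-13, `musinTarasov2012_tammes_thirteen`): at a
`55/57`-separated site at most twelve particles lie within distance `1`. [folklore] -/
theorem card_nbrs_le_twelve (hT : musinTarasov2012_tammes_thirteen) {x : Fin N → EuclideanSpace ℝ (Fin 3)} {i : Fin N}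
    (hsep : (∀ j, dist (x i) (x j) ≤ 11 / 10 → ∀ k, k ≠ j → (55 : ℝ) / 57 ≤ dist (x j) (x k))) : ((Finset.filter (fun j => j ≠ i ∧ dist (x i) (x j) ≤ 1) Finset.univ)).card ≤ 12 := by
  rw [← card_code hsep]
  exact hT _ (code_norm hsep) (code_dist hsep)

/-- **The count `12` cannot be raised** (modulo Tammes-13): the crux with `13` in place of `12` is
false — no site of any configuration satisfies the strengthened predicate, and ground states exist
for every `N`. [folklore] -/
theorem twelveWithinOne_false_with_thirteen (hT : musinTarasov2012_tammes_thirteen) :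
    ¬ ∀ x : (N : ℕ) → (Fin N → EuclideanSpace ℝ (Fin 3)), (∀ N, IsGroundState lennardJones (x N)) →
      Tendsto (fun N : ℕ => (Nat.card {i : Fin N // ¬ ((∀ j : Fin N, dist (x N i) (x N j) ≤ 11 / 10 →
        ∀ k : Fin N, k ≠ j → (55 : ℝ) / 57 ≤ dist (x N j) (x N k)) ∧
        13 ≤ (Finset.univ.filter fun j : Fin N => j ≠ i ∧ dist (x N i) (x N j) ≤ 1).card)} : ℝ) / N)
        atTop (nhds 0) := by
  intro h
  set gs : (N : ℕ) → (Fin N → EuclideanSpace ℝ (Fin 3)) := fun N => (LennardJonesGroundStatesExist_holds N).choose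
    with hgs
  have hgs' : ∀ N, IsGroundState lennardJones (gs N) := fun N =>
    (LennardJonesGroundStatesExist_holds N).choose_spec
  refine not_tendsto_of_forall_not (P := fun N i => ((∀ j, dist (gs N i) (gs N j) ≤ 11 / 10 → ∀ k, k ≠ j → (55 : ℝ) / 57 ≤ dist (gs N j) (gs N k))) ∧ 13 ≤ ((Finset.filter (fun j => j ≠ i ∧ dist (gs N i) (gs N j) ≤ 1) Finset.univ)).card)
    (fun N _ i hgood => ?_) (h gs hgs')
  have := card_nbrs_le_twelve hT hgood.1
  have h13 := hgood.2
  omega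

/-! ## Part C — surface sites are always defects: the exceptional set is essential -/

/-- **A particle extreme in some direction is a defect**, in every configuration: its bond
directions would be `≥ 12` unit vectors of a closed hemisphere pairwise at inner product
`≤ 1 − (55/57)²/2 ≤ 2·(219/250)² − 1`, but the cap-packing bound allows at most
`(1 + √(1 − c²))/(1 − c) = 11.95…` of them. [folklore] -/
theorem not_good_of_extreme {x : Fin N → EuclideanSpace ℝ (Fin 3)} {a : EuclideanSpace ℝ (Fin 3)} (ha : ‖a‖ = 1) {i : Fin N}
    (hmax : ∀ j : Fin N, ⟪a, x j⟫ ≤ ⟪a, x i⟫) :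
    ¬ (((∀ j, dist (x i) (x j) ≤ 11 / 10 → ∀ k, k ≠ j → (55 : ℝ) / 57 ≤ dist (x j) (x k))) ∧ 12 ≤ ((Finset.filter (fun j => j ≠ i ∧ dist (x i) (x j) ≤ 1) Finset.univ)).card) := by
  rintro ⟨hsep, hcount⟩
  have hna : ‖-a‖ = 1 := by rw [norm_neg, ha]
  have hhem : ∀ v ∈ (Finset.image (fun j => ‖x j - x i‖⁻¹ • (x j - x i)) (Finset.filter (fun j => j ≠ i ∧ dist (x i) (x j) ≤ 1) Finset.univ)), 0 ≤ ⟪-a, v⟫ := by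
    intro v hv
    obtain ⟨j, hj, rfl⟩ := Finset.mem_image.1 hv
    have h0 : 0 < ‖x j - x i‖ := by linarith [(norm_sub_mem hsep hj).1]
    rw [real_inner_smul_right, inner_neg_left, inner_sub_right]
    exact mul_nonneg (inv_nonneg.2 h0.le) (by linarith [hmax j])
  have hsep' : ∀ v ∈ (Finset.image (fun j => ‖x j - x i‖⁻¹ • (x j - x i)) (Finset.filter (fun j => j ≠ i ∧ dist (x i) (x j) ≤ 1) Finset.univ)), ∀ w ∈ (Finset.image (fun j => ‖x j - x i‖⁻¹ • (x j - x i)) (Finset.filter (fun j => j ≠ i ∧ dist (x i) (x j) ≤ 1) Finset.univ)), v ≠ w → ⟪v, w⟫ ≤ 2 * (219 / 250 : ℝ) ^ 2 - 1 :=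
    fun v hv w hw hvw => (code_inner hsep v hv w hw hvw).trans (by norm_num)
  have hb := card_mul_le_of_code_in_hemisphere (code_norm hsep) (c := 219 / 250) (by norm_num)
    (by norm_num) hsep' hna hhem
  have hsqrt : Real.sqrt (1 - (219 / 250 : ℝ) ^ 2) < 488 / 1000 := by
    rw [Real.sqrt_lt' (by norm_num)]; norm_num
  rw [card_code hsep] at hb
  have h12 : (12 : ℝ) ≤ ((Finset.filter (fun j => j ≠ i ∧ dist (x i) (x j) ≤ 1) Finset.univ)).card := by exact_mod_cast hcount
  linarith

/-- Hence **every non-empty configuration has a defect site** (the particle maximising the first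
coordinate). [folklore] -/
theorem exists_not_good (hN : 1 ≤ N) (x : Fin N → EuclideanSpace ℝ (Fin 3)) :
    ∃ i : Fin N, ¬ (((∀ j, dist (x i) (x j) ≤ 11 / 10 → ∀ k, k ≠ j → (55 : ℝ) / 57 ≤ dist (x j) (x k))) ∧ 12 ≤ ((Finset.filter (fun j => j ≠ i ∧ dist (x i) (x j) ≤ 1) Finset.univ)).card) := by
  have ha : ‖(EuclideanSpace.single (0 : Fin 3) (1 : ℝ) : EuclideanSpace ℝ (Fin 3))‖ = 1 := by simp
  have hne : (Finset.univ : Finset (Fin N)).Nonempty := Finset.univ_nonempty_iff.2 ⟨⟨0, hN⟩⟩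
  obtain ⟨i, -, hi⟩ := Finset.exists_max_image Finset.univ
    (fun j => ⟪(EuclideanSpace.single (0 : Fin 3) (1 : ℝ) : EuclideanSpace ℝ (Fin 3)), x j⟫) hne
  exact ⟨i, not_good_of_extreme ha fun j => hi j (Finset.mem_univ j)⟩

/-- Quantitative form: **the defect set of the crux is never empty** (`N ≥ 1`, any configuration,
ground state or not). [folklore] -/
theorem one_le_card_bad (hN : 1 ≤ N) (x : Fin N → EuclideanSpace ℝ (Fin 3)) :
    1 ≤ Nat.card {i : Fin N // ¬ ((∀ j : Fin N, dist (x i) (x j) ≤ 11 / 10 →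
        ∀ k : Fin N, k ≠ j → (55 : ℝ) / 57 ≤ dist (x j) (x k)) ∧
        12 ≤ (Finset.univ.filter fun j : Fin N => j ≠ i ∧ dist (x i) (x j) ≤ 1).card)} := by
  obtain ⟨i, hi⟩ := exists_not_good hN x
  have : Nonempty {i : Fin N // ¬ (((∀ j, dist (x i) (x j) ≤ 11 / 10 → ∀ k, k ≠ j → (55 : ℝ) / 57 ≤ dist (x j) (x k))) ∧ 12 ≤ ((Finset.filter (fun j => j ≠ i ∧ dist (x i) (x j) ≤ 1) Finset.univ)).card)} := ⟨⟨i, hi⟩⟩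
  exact Nat.card_pos

/-- **The exceptional set is essential**: the natural strengthening of the crux with NO exceptional
set — for every ground-state sequence, eventually every particle is Good — is false. [folklore] -/
theorem twelveWithinOne_false_everywhere :
    ¬ ∀ x : (N : ℕ) → (Fin N → EuclideanSpace ℝ (Fin 3)), (∀ N, IsGroundState lennardJones (x N)) →
      ∀ᶠ N in atTop, ∀ i : Fin N, (∀ j : Fin N, dist (x N i) (x N j) ≤ 11 / 10 →
        ∀ k : Fin N, k ≠ j → (55 : ℝ) / 57 ≤ dist (x N j) (x N k)) ∧
        12 ≤ (Finset.univ.filter fun j : Fin N => j ≠ i ∧ dist (x N i) (x N j) ≤ 1).card := by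
  intro h
  set gs : (N : ℕ) → (Fin N → EuclideanSpace ℝ (Fin 3)) := fun N => (LennardJonesGroundStatesExist_holds N).choose
    with hgs
  have hgs' : ∀ N, IsGroundState lennardJones (gs N) := fun N =>
    (LennardJonesGroundStatesExist_holds N).choose_spec
  obtain ⟨N, hN1, hN⟩ := ((eventually_ge_atTop 1).and (h gs hgs')).exists
  obtain ⟨i, hi⟩ := exists_not_good hN1 (gs N)
  exact hi (hN i)

end Summit.AtomisticToContinuum.Crystallization.Theorems.TwelveWithinOne.Negative

end
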